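import Summits.ResolutionOfSingularities.ResolutionOfSingularities.Theorems.WildConesCampaignW46ForcedAtomsRegime
import Summits.ResolutionOfSingularities.ResolutionOfSingularities.Theorems.WildConesCampaignW46ForcedAtomsFiniteSingWitness
import HarnessLib

/-!
# [OURS · L1 W4.6, rung (i) SURFACES IN 3-SPACE / CURVES IN THE PLANE, GEOMETRIC FORM — brick 35] The named rungs
# `ForcedAtomsFin{FinLocalExitBound,PermissiblyTerminates,Terminates} p K n` CLOSED BY NAME for `n = 2` and `n = 1`
# (`K` algebraically closed, every `p`), on an inhabited regime

Cell res-hironaka (LADDER-RESOLUTION rung L, D-0089), slot W4.6 «restricted regimes as rungs», seat res-L1-s46-pv-2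
(gen 5). Host: route `WildCones`, crux `ClassicalRegimes` (stmt-ResolutionOfSingularities-16884),
`--supports … --as helper`.

HONEST FRAMING. Everything here is OURS; one-line closers of the named rungs of `…W46ForcedAtomsRegime.lean` by this
seat's theorems `finLocalExitBound_of_le_forcedAtoms{Surface,Curve}` (brick 33) and the non-vacuity of brick 34. NOTHING
here is a statement of H. Hironaka's manuscript [Hironaka2017]; no FACT-LIST premise. AI review is weaker than expert
review.

## What is proved (`K` algebraically closed of characteristic `p`, every prime `p`)

* `forcedAtomsFinFinLocalExitBound_two` / `_one` — `ForcedAtomsFinFinLocalExitBound p K 2` (surfaces in a smooth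
  threefold) and `… p K 1` (curves in a smooth surface) HOLD.
* `forcedAtomsFinPermissiblyTerminates_two` / `_one`, `forcedAtomsFinTerminates_two` / `_one` — the résumé-free and
  typed shapes.
* `forcedAtomsFinFinLocalExitBound_two_and_inhabited` — the surface rung together with a standard state of the regime
  with non-empty singular locus (the Fermat surface on `𝔸³`).

References: bricks 33/34 and the regime file of this seat; H. Hironaka, ms. 2017, Th. 16.6 p.84, Th. 16.13 p.87 — ROLE
only, under adjudication, not cited as fact. [folklore]
-/

noncomputable section

-- single-problem summit: the doubled namespace component `ResolutionOfSingularities` is forced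
set_option linter.dupNamespace false

open scoped BigOperators Classical
open MvPowerSeries IsLocalRing

namespace Summit.ResolutionOfSingularities.ResolutionOfSingularities.Theorems

namespace CampaignW46

open CategoryTheory AlgebraicGeometry TopologicalSpace
open Literature.AlgebraicGeometry.Resolution
open Literature.AlgebraicGeometry.Hironaka2017.S02Preliminaries
open Scheme.IdealSheafData
open WildCones

variable {p : ℕ} [Fact p.Prime] {K : Type} [Field K] [CharP K p] [IsAlgClosed K]

/-- [OURS · L1 W4.6 rung (i) SURFACES IN 3-SPACE, geometric form — CLOSED BY NAME; NOT a statement of the manuscript]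
`ForcedAtomsFinFinLocalExitBound p K 2` holds (brick 33 at the named regime with the identity inclusion). [folklore] -/
theorem forcedAtomsFinFinLocalExitBound_two : ForcedAtomsFinFinLocalExitBound p K 2 :=
  ForcedAtom.finLocalExitBound_of_le_forcedAtomsSurface _ fun _ _ h => h

/-- [OURS · L1 W4.6 rung (i) CURVES IN THE PLANE, geometric form — CLOSED BY NAME; NOT a statement of the manuscript]
`ForcedAtomsFinFinLocalExitBound p K 1` holds. [folklore] -/
theorem forcedAtomsFinFinLocalExitBound_one : ForcedAtomsFinFinLocalExitBound p K 1 :=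
  ForcedAtom.finLocalExitBound_of_le_forcedAtomsCurve _ fun _ _ h => h

/-- [OURS · L1 W4.6; NOT a statement of the manuscript] The résumé-free rung for surfaces, by name. [folklore] -/
theorem forcedAtomsFinPermissiblyTerminates_two : ForcedAtomsFinPermissiblyTerminates p K 2 :=
  forcedAtomsFinPermissiblyTerminates_of_finLocalExitBound forcedAtomsFinFinLocalExitBound_two

/-- [OURS · L1 W4.6; NOT a statement of the manuscript] The résumé-free rung for curves, by name. [folklore] -/
theorem forcedAtomsFinPermissiblyTerminates_one : ForcedAtomsFinPermissiblyTerminates p K 1 :=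
  forcedAtomsFinPermissiblyTerminates_of_finLocalExitBound forcedAtomsFinFinLocalExitBound_one

/-- [OURS · L1 W4.6; NOT a statement of the manuscript] The typed rung for surfaces, by name (every `m`, `N`, `Rd`).
[folklore] -/
theorem forcedAtomsFinTerminates_two : ForcedAtomsFinTerminates p K 2 :=
  forcedAtomsFinTerminates_of_permissibly forcedAtomsFinPermissiblyTerminates_two

/-- [OURS · L1 W4.6; NOT a statement of the manuscript] The typed rung for curves, by name. [folklore] -/
theorem forcedAtomsFinTerminates_one : ForcedAtomsFinTerminates p K 1 :=
  forcedAtomsFinTerminates_of_permissibly forcedAtomsFinPermissiblyTerminates_one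

/-- [OURS · L1 W4.6 rung (i) SURFACES IN 3-SPACE on an INHABITED regime; NOT a statement of the manuscript] The named
surface rung holds AND `Regime.forcedAtomsFin 2` contains a standard state with non-empty singular locus (brick 34).
[folklore] -/
theorem forcedAtomsFinFinLocalExitBound_two_and_inhabited :
    ForcedAtomsFinFinLocalExitBound p K 2 ∧
      ∃ (A : AmbientDatum p K) (E : IdealExponent A.Z),
        Regime.forcedAtomsFin (p := p) (K := K) 2 A E ∧ E.IsStandard ∧ E.sing.Nonempty :=
  ⟨forcedAtomsFinFinLocalExitBound_two, ForcedAtom.finLocalExitBound_forcedAtomsSurface_and_inhabited.2⟩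

end CampaignW46

end Summit.ResolutionOfSingularities.ResolutionOfSingularities.Theorems

end
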